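import Summits.AtomisticToContinuum.FouriersLaw.Theses.BondHeatUncertainty
import Literature.Probability.Entropy.StrongDataProcessingProofs

/-!
# `LinearResponseFTUR` (stmt-AtomisticToContinuum-9122): formal shield, `δ → 0` bookkeeping certificate, KL symmetry

Negative-lane lemmas from the standing disprover of crux (★) `LinearResponseFTUR` of route
`BondHeatUncertainty` (work file `Cruxes/LinearResponseFTUR/Disproof.lean`, §§6–8, cycle 2). None of them
asserts a Theses statement; they record WHY the crux resists refutation:

* `nessUnique_of_not_linearResponseFTUR` — the formal shield: any proof of `¬ LinearResponseFTUR` yields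
  weak-NESS uniqueness (item 0741, open) for some positive parameters at every `N, T_L, T_R`.
* `tendsto_entropyProduction_div_sq` — `σ_δ = J_δ(1/T_R − 1/T_L)` at `T_L = T + δ/2`, `T_R = T − δ/2` with
  `J_δ/δ → G` satisfies `σ_δ/δ² → G/T²` (the `T²` of (★)).
* `fturShape_pointwise_of_hvv_family` — the whole `δ → 0` bookkeeping of (★) as a theorem on real families:
  Hasegawa–Van Vu at each `δ` + `⟨Q_t⟩_δ/δ → Gt` + `Var_δ(Q_t) → V` + entropy balance
  `⟨Σ_t⟩ ≤ J_δ(1/T_R − 1/T_L)t + Kδ²` ⟹ `2G²t² ≤ V(Gt/T² + K)` EXACTLY (no sign hypothesis on `G`, `K` needed).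
  So a refutation can only live in the four physical inputs, never in the constants.
* `klDiv_momentumFlip_comm` — `KL(Θ_*μ‖μ) = KL(μ‖Θ_*μ)` for the momentum flip and every finite `μ`: the
  direction in hypothesis (b) is immaterial.
-/

namespace Summit.AtomisticToContinuum.FouriersLaw.Theorems.LinearResponseFTUR.Negative

open MeasureTheory Filter Topology
open Literature.MathematicalPhysics.KineticTheory.HeatConduction
open Summit.AtomisticToContinuum.FouriersLaw.Theses.BondHeatUncertainty

noncomputable section

/-- **Formal shield.** Any refutation of the crux proves weak-NESS uniqueness (item 0741 `NessUnique`,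
open) for SOME positive parameters, at every `N` and all bath temperatures. -/
theorem nessUnique_of_not_linearResponseFTUR (h : ¬ LinearResponseFTUR) :
    ∃ ω₂ lam β γ : ℝ, 0 < ω₂ ∧ 0 < lam ∧ 0 < β ∧ 0 < γ ∧
      ∀ (N : ℕ) (T_L T_R : ℝ), 0 < T_L → 0 < T_R → ∀ μ ν : Measure (PhaseSpace N),
        (pinnedChain ω₂ lam β γ).IsSteadyState N T_L T_R μ →
        (pinnedChain ω₂ lam β γ).IsSteadyState N T_L T_R ν → μ = ν := by
  by_contra hne
  exact h fun ω₂ lam β γ hω hl hβ hγ huniq =>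
    (hne ⟨ω₂, lam, β, γ, hω, hl, hβ, hγ, huniq⟩).elim

/-! ## The `δ → 0` bookkeeping certificate -/

/-- Carnot factor algebra: `1/(T - δ/2) - 1/(T + δ/2) = δ / (T² - δ²/4)`. -/
theorem inv_sub_inv_temperatures {T δ : ℝ} (h₁ : T - δ / 2 ≠ 0) (h₂ : T + δ / 2 ≠ 0) :
    1 / (T - δ / 2) - 1 / (T + δ / 2) = δ / (T ^ 2 - δ ^ 2 / 4) := by
  have h3 : T ^ 2 - δ ^ 2 / 4 = (T - δ / 2) * (T + δ / 2) := by ring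
  rw [h3, div_sub_div _ _ h₁ h₂]
  congr 1
  ring

/-- **Entropy-production asymptotics (`σ_δ = G δ²/T² + o(δ²)`).** If the mean bond current satisfies
`J δ / δ → G` then the thermodynamic entropy production rate `σ_δ = J_δ (1/T_R - 1/T_L)` at
`T_L = T + δ/2`, `T_R = T - δ/2` satisfies `σ_δ / δ² → G / T²`. Certifies the `T²` of (★). -/
theorem tendsto_entropyProduction_div_sq {J : ℝ → ℝ} {G T : ℝ} (hT : 0 < T)
    (hJ : Tendsto (fun δ => J δ / δ) (𝓝[≠] 0) (𝓝 G)) :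
    Tendsto (fun δ => J δ * (1 / (T - δ / 2) - 1 / (T + δ / 2)) / δ ^ 2) (𝓝[≠] 0)
      (𝓝 (G / T ^ 2)) := by
  -- eventually |δ| < T, so the Carnot factor is δ/(T² - δ²/4)
  have hI : ∀ᶠ δ in 𝓝[≠] (0 : ℝ), δ ∈ Set.Ioo (-T) T ∧ δ ≠ 0 := by
    have h1 : ∀ᶠ δ in 𝓝 (0 : ℝ), δ ∈ Set.Ioo (-T) T := Ioo_mem_nhds (by linarith) hT
    have h1' : ∀ᶠ δ in 𝓝[≠] (0 : ℝ), δ ∈ Set.Ioo (-T) T := mem_nhdsWithin_of_mem_nhds h1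
    have h2' : ∀ᶠ δ in 𝓝[≠] (0 : ℝ), δ ≠ 0 := self_mem_nhdsWithin
    exact h1'.and h2'
  have hden : Tendsto (fun δ : ℝ => T ^ 2 - δ ^ 2 / 4) (𝓝[≠] 0) (𝓝 (T ^ 2)) := by
    have : Tendsto (fun δ : ℝ => T ^ 2 - δ ^ 2 / 4) (𝓝 0) (𝓝 (T ^ 2 - 0 ^ 2 / 4)) :=
      ((continuous_const.sub ((continuous_pow 2).div_const 4)).tendsto 0)
    simpa using this.mono_left nhdsWithin_le_nhds
  have hlim : Tendsto (fun δ => J δ / δ / (T ^ 2 - δ ^ 2 / 4)) (𝓝[≠] 0) (𝓝 (G / T ^ 2)) :=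
    hJ.div hden (by positivity)
  refine hlim.congr' ?_
  filter_upwards [hI] with δ hδ
  obtain ⟨⟨hlo, hhi⟩, hne⟩ := hδ
  have h₁ : T - δ / 2 ≠ 0 := by intro h; linarith
  have h₂ : T + δ / 2 ≠ 0 := by intro h; linarith
  have h₃ : T ^ 2 - δ ^ 2 / 4 ≠ 0 := by
    have : T ^ 2 - δ ^ 2 / 4 = (T - δ / 2) * (T + δ / 2) := by ring
    rw [this]; exact mul_ne_zero h₁ h₂
  rw [inv_sub_inv_temperatures h₁ h₂]
  field_simp

/-- **Bookkeeping certificate (the `δ → 0` step of (★) is exactly right).** At one bond, one `t > 0`: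
let `m δ = ⟨Q_t⟩_δ`, `v δ = Var_δ(Q_t)`, `s δ = ⟨Σ_t⟩_δ` along the two-temperature steady states
`T ± δ/2`. Assume, eventually as `δ → 0` (`δ ≠ 0`):
* the Hasegawa–Van Vu FTUR at each `δ`: `m² ≤ ½ v (e^s - 1)` (`Literature.Probability.Entropy.HasegawaVanVu2019_FTUR`);
* `v ≥ 0`;
* the mean: `m δ / δ → G t` (stationarity `⟨Q_t⟩ = t J_δ` and `J_δ/δ → G = D_N/(N-1)`);
* δ-continuity of the variance: `v δ → V` (`= V_N(b,t)`);
* the entropy balance with the snapshot bound: `s δ ≤ (m δ/t)(1/(T-δ/2) - 1/(T+δ/2)) t + K δ²`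
  (`⟨Σ_t⟩ = σ_δ t + KL(μ_δ‖Θ_*μ_δ)`, `σ_δ = J_δ (1/T_R - 1/T_L)`, `KL ≤ K δ²`).
Then `2 G² t² ≤ V (G t/T² + K)` — conclusion (b) of the crux with all its constants. So the only
room for a refutation is in the four physical inputs, never in the limit bookkeeping. -/
theorem fturShape_pointwise_of_hvv_family {m v s : ℝ → ℝ} {G T K V t : ℝ} (ht : 0 < t)
    (hT : 0 < T)
    (hHVV : ∀ᶠ δ in 𝓝[≠] (0 : ℝ), m δ ^ 2 ≤ 1 / 2 * v δ * (Real.exp (s δ) - 1))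
    (hv0 : ∀ᶠ δ in 𝓝[≠] (0 : ℝ), 0 ≤ v δ)
    (hm : Tendsto (fun δ => m δ / δ) (𝓝[≠] 0) (𝓝 (G * t)))
    (hv : Tendsto v (𝓝[≠] 0) (𝓝 V))
    (hs : ∀ᶠ δ in 𝓝[≠] (0 : ℝ),
      s δ ≤ m δ / t * (1 / (T - δ / 2) - 1 / (T + δ / 2)) * t + K * δ ^ 2) :
    2 * G ^ 2 * t ^ 2 ≤ V * (G * t / T ^ 2 + K) := by
  -- the entropy bound is δ² · w δ with w δ → G t / T² + K
  set w : ℝ → ℝ := fun δ => m δ / δ / (T ^ 2 - δ ^ 2 / 4) + K with hw_def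
  have hI : ∀ᶠ δ in 𝓝[≠] (0 : ℝ), δ ∈ Set.Ioo (-T) T ∧ δ ≠ 0 := by
    have h1 : ∀ᶠ δ in 𝓝 (0 : ℝ), δ ∈ Set.Ioo (-T) T := Ioo_mem_nhds (by linarith) hT
    have h1' : ∀ᶠ δ in 𝓝[≠] (0 : ℝ), δ ∈ Set.Ioo (-T) T := mem_nhdsWithin_of_mem_nhds h1
    have h2' : ∀ᶠ δ in 𝓝[≠] (0 : ℝ), δ ≠ 0 := self_mem_nhdsWithin
    exact h1'.and h2'
  have hden : Tendsto (fun δ : ℝ => T ^ 2 - δ ^ 2 / 4) (𝓝[≠] 0) (𝓝 (T ^ 2)) := by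
    have : Tendsto (fun δ : ℝ => T ^ 2 - δ ^ 2 / 4) (𝓝 0) (𝓝 (T ^ 2 - 0 ^ 2 / 4)) :=
      ((continuous_const.sub ((continuous_pow 2).div_const 4)).tendsto 0)
    simpa using this.mono_left nhdsWithin_le_nhds
  have hw : Tendsto w (𝓝[≠] 0) (𝓝 (G * t / T ^ 2 + K)) :=
    (hm.div hden (by positivity)).add tendsto_const_nhds
  have hsq : Tendsto (fun δ : ℝ => δ ^ 2) (𝓝[≠] 0) (𝓝 0) := by
    have : Tendsto (fun δ : ℝ => δ ^ 2) (𝓝 0) (𝓝 (0 ^ 2)) := (continuous_pow 2).tendsto 0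
    simpa using this.mono_left nhdsWithin_le_nhds
  have hx : Tendsto (fun δ : ℝ => δ ^ 2 * w δ) (𝓝[≠] 0) (𝓝 0) := by
    simpa using hsq.mul hw
  have hexp : Tendsto (fun δ : ℝ => Real.exp (δ ^ 2 * w δ)) (𝓝[≠] 0) (𝓝 1) := by
    have := (Real.continuous_exp.tendsto 0).comp hx
    simpa [Function.comp_def] using this
  -- the entropy bound rewritten
  have hs' : ∀ᶠ δ in 𝓝[≠] (0 : ℝ), s δ ≤ δ ^ 2 * w δ := by
    filter_upwards [hs, hI] with δ hδ hδI
    obtain ⟨⟨hlo, hhi⟩, hne⟩ := hδI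
    have h₁ : T - δ / 2 ≠ 0 := by intro h; linarith
    have h₂ : T + δ / 2 ≠ 0 := by intro h; linarith
    have h₃ : T ^ 2 - δ ^ 2 / 4 ≠ 0 := by
      have : T ^ 2 - δ ^ 2 / 4 = (T - δ / 2) * (T + δ / 2) := by ring
      rw [this]; exact mul_ne_zero h₁ h₂
    have e : m δ / t * (1 / (T - δ / 2) - 1 / (T + δ / 2)) * t + K * δ ^ 2 = δ ^ 2 * w δ := by
      rw [inv_sub_inv_temperatures h₁ h₂, hw_def]
      field_simp
    linarith [hδ, e.le, e.ge]
  -- the chain of inequalities at each δ, divided by δ²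
  have hev : ∀ᶠ δ in 𝓝[≠] (0 : ℝ),
      (m δ / δ) ^ 2 ≤ 1 / 2 * v δ * (w δ * Real.exp (δ ^ 2 * w δ)) := by
    filter_upwards [hHVV, hv0, hs', hI] with δ h1 h2 h3 hδI
    obtain ⟨-, hne⟩ := hδI
    have hδ2 : 0 < δ ^ 2 := by positivity
    have h4 : Real.exp (s δ) - 1 ≤ Real.exp (δ ^ 2 * w δ) - 1 := by
      linarith [Real.exp_le_exp.mpr h3]
    -- `exp x - 1 ≤ x · exp x` (from `1 - x ≤ exp (-x)`)
    have h5 : Real.exp (δ ^ 2 * w δ) - 1 ≤ δ ^ 2 * w δ * Real.exp (δ ^ 2 * w δ) := by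
      have h := Real.add_one_le_exp (-(δ ^ 2 * w δ))
      have hx := Real.exp_pos (δ ^ 2 * w δ)
      have : Real.exp (-(δ ^ 2 * w δ)) * Real.exp (δ ^ 2 * w δ) = 1 := by
        rw [← Real.exp_add]; simp
      nlinarith
    have h6 : m δ ^ 2 ≤ 1 / 2 * v δ * (δ ^ 2 * w δ * Real.exp (δ ^ 2 * w δ)) := by
      have := mul_le_mul_of_nonneg_left (h4.trans h5) (by positivity : (0 : ℝ) ≤ 1 / 2 * v δ)
      exact h1.trans this
    rw [div_pow, div_le_iff₀ hδ2]
    calc m δ ^ 2 ≤ 1 / 2 * v δ * (δ ^ 2 * w δ * Real.exp (δ ^ 2 * w δ)) := h6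
      _ = 1 / 2 * v δ * (w δ * Real.exp (δ ^ 2 * w δ)) * δ ^ 2 := by ring
  have hL : Tendsto (fun δ => (m δ / δ) ^ 2) (𝓝[≠] 0) (𝓝 ((G * t) ^ 2)) := hm.pow 2
  have hR : Tendsto (fun δ => 1 / 2 * v δ * (w δ * Real.exp (δ ^ 2 * w δ))) (𝓝[≠] 0)
      (𝓝 (1 / 2 * V * ((G * t / T ^ 2 + K) * 1))) :=
    (tendsto_const_nhds.mul hv).mul (hw.mul hexp)
  have key : (G * t) ^ 2 ≤ 1 / 2 * V * ((G * t / T ^ 2 + K) * 1) :=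
    le_of_tendsto_of_tendsto hL hR hev
  nlinarith [key]

/-! ## The direction of the snapshot KL is immaterial -/

/-- **KL direction is immaterial for the momentum flip.** For every finite measure `μ` on phase space,
`KL(Θ_*μ ‖ μ) = KL(μ ‖ Θ_*μ)` (`Θ` an involutive measurable equivalence; KL is invariant under pushing both
arguments forward by `Θ`). So cards writing the entropy balance with `KL(Θμ_δ‖μ_δ)` feed the crux's
hypothesis `KL(μ_δ‖Θμ_δ) ≤ Kδ²` verbatim. -/
theorem klDiv_momentumFlip_comm {N : ℕ} (μ : Measure (PhaseSpace N)) [IsFiniteMeasure μ] :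
    InformationTheory.klDiv (μ.map fun x : PhaseSpace N => (x.1, -x.2)) μ =
      InformationTheory.klDiv μ (μ.map fun x : PhaseSpace N => (x.1, -x.2)) := by
  have e : (fun x : PhaseSpace N => (x.1, -x.2)) = ⇑(momentumReversal N) := by
    funext x; rfl
  rw [e]
  have hΘΘ : (⇑(momentumReversal N)) ∘ (⇑(momentumReversal N)) = id := by
    funext x
    simp [momentumReversal_apply]
  have hback : (μ.map (momentumReversal N)).map (momentumReversal N) = μ := by
    rw [Measure.map_map (momentumReversal N).measurable (momentumReversal N).measurable, hΘΘ,
      Measure.map_id]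
  have h := Literature.Probability.Entropy.klDiv_map_of_measurableEmbedding
    (momentumReversal N).measurableEmbedding μ (μ.map (momentumReversal N))
  rw [hback] at h
  exact h

end

end Summit.AtomisticToContinuum.FouriersLaw.Theorems.LinearResponseFTUR.Negative
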